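import Summits.QuantumFields.YangMills.Theorems.FluctuationComparisonRegPrIntLS2BetaChartReadCplxExtension
import HarnessLib

/-!
# S2β · (β-2) THE COMPLEXIFIED ONE-STEP CHART-READ (0.4) EML AVERAGE `Φ_c = log ∘ G_c` IS HOLOMORPHIC AND BOUNDED ON THE SUP-NORM POLYDISC, AND ON THE REAL SLICE IT IS THE
# CHART-READ AVERAGE `ψ_{U₀}(·)(c)` OF pub-ymgap N09 ∕ (D1), WITH THE SAME DERIVATIVE AT `0` ([Balaban1985Averaging] Prop. 3 p.36 «analytic function of A», quantified)

Cell `ym3-torus` (YM ladder rung R3 = continuum `SU(2)` Yang–Mills on the three-torus at fixed lattice data — a RUNG: NOT d = 4, NOT infinite volume, NOT a mass gap,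
NOT Clay).  Width seat `ym3-torus-px13` (gen 26); crux `stmt-QuantumFields-20520`, LINE g18-1 S2β, pairing lane, AVG₂♭-ax_q route (UV3-NODE §89.7) step (2) = the ORDER-2
ONE-STEP BRICK; sequel of (β-1) ✓`…ChartReadCplxExtension` (objects `σ_A`, `W_A(γ)`, `G_c(A)`, `‖G_c(A) − 1‖ ≤ 27ℓ(e^{‖A‖} − 1)`), read by (β-3) `…ChartReadSecondOrder`.
`--kind proof --supports stmt-QuantumFields-20520 --as helper`, count-neutral, DEFINITION-FREE (0 `def` ∕ `instance` ∕ `notation` ∕ `sorry`).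

OBJECTS (as (β-1); generic `P : Params`, `SU(N)`, level `j`, `M = M_N(ℂ)`): `Φ_c(A) := log(G_c(A))` with `log` = lit `MatrixLog.mlog`; the POLYDISC CONDITION at `A` is
`100·ℓ·(e^{‖A‖} − 1) ≤ ρ` where `4α ≤ ρ ≤ innerRadius (specialUnitaryLogChart (Fin N))` and `dist1 (loopHol U₀ c i) ≤ α` (the loop `α`-guard of (D1)); the real chart-read
average is written out: `ψ_{U₀}(X)(c) = Λ(Ū(Θ^B(X)·U₀)(c)·Ū(U₀)(c)⁻¹)`, `Θ = expChart`, `Λ = logChart` of `isChartRep_specialUnitaryGroup`, `Ū = avgFun expMeanLogSU`.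

WHAT IS PROVED (sorry-free).
* §1 `analyticAt_loopTupleC`; `norm_loopTupleC_sub_one_le` (`≤ ρ∕50 + ρ∕4`); ★`analyticAt_cplxRelAvg`; `cplxRelAvg_zero` (`G_c(0) = 1`); ★★`analyticAt_cplxChartRead`;
  ★★`analyticOnNhd_cplxChartRead` ∕ `differentiableOn_cplxChartRead` on `ball 0 a` whenever `100·ℓ·(e^a − 1) ≤ ρ`; `cplxChartRead_zero` (`Φ_c(0) = 0`);
  ★★`norm_cplxChartRead_le` (**`‖Φ_c(A)‖ ≤ 54·ℓ·(e^{‖A‖} − 1)`**, via `‖log W‖ ≤ −log(1 − ‖W − 1‖) ≤ 2‖W − 1‖`).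
* §2 `norm_coePi_le` (`‖X̂‖ ≤ ‖X‖`); `small_piExpChart_translate` (on the polydisc the chart point `Θ^B(X)·U₀` is inside the (0.4) guard at `c`); ★★`coe_relAvg_eq_cplxRelAvg`
  (`↑(Ū(Θ^B(X)·U₀)(c)·Ū(U₀)(c)⁻¹) = G_c(X̂)`); ★★★`coe_chartRead_eq_cplxChartRead` (**`↑(ψ_{U₀}(X)(c)) = Φ_c(X̂)`** on the polydisc: `‖G_c − 1‖ < ρ ≤` inner radius so `Λ = log`);
★`norm_coe_relAvg_sub_one_le` (the relative average is within `27ℓ(e^{‖X‖} − 1) < ρ` of `1`: the `hwin` of Q1∕Q8 DISCHARGED from `‖X‖`), ★`norm_coe_chartRead_le`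
  (`‖↑(ψ_{U₀}(X)(c))‖ ≤ 54ℓ(e^{‖X‖} − 1)`); ★★★`coe_fderiv_chartRead_apply_eq` (**`↑((Dψ_{U₀}(0) X)(c)) = DΦ_c(0) X̂`**, for `U₀` in the guard at every coarse bond: `↑∘ψ(·)(c) = Φ_c ∘ (X ↦ X̂)` near `0`, chain rule through the
  real-linear inclusion, `restrictScalars`; uses pub-ymgap N09 ✓`contDiffAt_chartRead_avgFun`, ✓`coe_fderiv_apply_eq`).

HONEST.  Kernel calculus on the tree's OWN averaging; the printed clause «analytic function of A» made quantitative (radius, bound) for the tree's `ψ`; NO estimate of Bałaban's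
renormalisation analysis; (123) is (β-3); pair weights (§89.4), AVG₂♭-ax_q, Q6∕Q7, «MULT♭-ax»∕«CRIT-ax», (D-ax), GAP♯∘ (registry UNTOUCHED), the five REGISTERED stubs, S2β, crux
20520, 19936, 19200 and `YM3TorusSU2` are NOT proved; no summit statement is proved by a helper; rung R3 = SU(2) YM₃ on T³ at fixed lattice data — NOT d = 4, NOT infinite
volume, NOT a mass gap, NOT Clay; the Yang–Mills mass gap is NOT proved.  Axioms standard.

References: [Balaban1985Averaging] CMP **98** (1985) Prop. 3 (120)–(123) p.36; [Balaban1987RG1] CMP **109** (1987) (0.4) p.253; [Helgason2000] Ch. I §1 Thm 1.14.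
-/

set_option autoImplicit false

noncomputable section

open scoped Matrix.Norms.L2Operator Topology
open Filter Set Function Metric

namespace Summit.QuantumFields.YangMills.Theorems.FluctuationComparisonRegPrIntLS2BetaChartReadCplxAnalytic

open Literature.MathematicalPhysics.QuantumFieldTheory.Balaban1983to89
open Literature.MathematicalPhysics.QuantumFieldTheory.Balaban1983to89.HaarExponentialChart
open Literature.MathematicalPhysics.QuantumFieldTheory.Balaban1983to89.HaarExponentialChart.IsChartRep
open Literature.MathematicalPhysics.QuantumFieldTheory.Balaban1983to89.BlockAveraging (Small Idx avgFun loopHol off corr)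
open Literature.MathematicalPhysics.QuantumFieldTheory.Balaban1983to89.ExpMeanLog (eml expMeanLogSU deltaSU deltaSU_pos)
open Literature.MathematicalPhysics.QuantumFieldTheory.Balaban1983to89.Node00
open Literature.MathematicalPhysics.QuantumFieldTheory.Balaban1983to89.T4Continuum (walk holAt LStep loopWord)
open Literature.MathematicalPhysics.QuantumLattice (fundamentalRep fundamentalRep_apply)
open MatrixLog (mlog analyticAt_mlog mlog_one norm_mlog_le_neg_log)
open Summit.QuantumFields.YangMills.BalabanUVNodes.N09ChartReadAveragingSmooth
open Summit.QuantumFields.YangMills.BalabanUVNodes.N09CentralWindowInjective (norm_coe_SU_le_one)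
open Summit.QuantumFields.YangMills.Theorems.FluctuationComparisonRegPrIntLS2BetaChartReadCplxExtension

variable {P : Params} {j : ℕ} {N : ℕ} [NeZero N] (U₀ : GaugeField P j (SU N))

/-! ## §1 `G_c` and `Φ_c = log ∘ G_c` are holomorphic on the polydisc `100·ℓ·(e^{‖A‖} − 1) ≤ ρ`; `Φ_c(0) = 0`; `‖Φ_c(A)‖ ≤ 54·ℓ·(e^{‖A‖} − 1)` -/

section Holo

omit [NeZero N] in
/-- The complexified loop tuple is an entire (analytic) function of the complex bond field. [cite: Balaban1987RG1, p.253 («analytic function»; bookkeeping)] -/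
theorem analyticAt_loopTupleC (c : PBond P (j + 1)) (A₀ : PBond P j → Matrix (Fin N) (Fin N) ℂ) :
    AnalyticAt ℂ (fun A : PBond P j → Matrix (Fin N) (Fin N) ℂ => (fun i : Idx P => ((walk (emb c.src) (loopWord P.L c.dir (off i.1) i.2.1 i.2.2)).map (fun s : LStep P j => if s.fwd then NormedSpace.exp (A s.bond) * ((U₀ s.bond : SU N) : Matrix (Fin N) (Fin N) ℂ) else star ((U₀ s.bond : SU N) : Matrix (Fin N) (Fin N) ℂ) * NormedSpace.exp (-(A s.bond)))).prod)) A₀ :=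
  AnalyticAt.pi fun _ => analyticAt_holC U₀ _ A₀

/-- On the polydisc the complexified loop tuple lies in `eml`'s polydisc `ball 1 (1∕3)` (indeed within `ρ∕50 + ρ∕4` of `1`). [cite: Balaban1987RG1, (0.4) p.253 (bookkeeping)] -/
theorem norm_loopTupleC_sub_one_le (c : PBond P (j + 1)) {α ρ : ℝ} (hρ : ρ ≤ innerRadius (specialUnitaryLogChart (Fin N)))
    (hα : ∀ i, dist1 (loopHol U₀ c i) ≤ α) (hα4 : 4 * α ≤ ρ) (A : PBond P j → Matrix (Fin N) (Fin N) ℂ)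
    (hA : 100 * ((((P.d + 2) * P.L : ℕ) : ℝ) * (Real.exp ‖A‖ - 1)) ≤ ρ) :
    ‖(fun i : Idx P => ((walk (emb c.src) (loopWord P.L c.dir (off i.1) i.2.1 i.2.2)).map (fun s : LStep P j => if s.fwd then NormedSpace.exp (A s.bond) * ((U₀ s.bond : SU N) : Matrix (Fin N) (Fin N) ℂ) else star ((U₀ s.bond : SU N) : Matrix (Fin N) (Fin N) ℂ) * NormedSpace.exp (-(A s.bond)))).prod) - 1‖ ≤ ρ / 50 + ρ / 4 := by
  have hρ3 : ρ ≤ 1 / 3 := hρ.trans innerRadius_le_third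
  have hT := (norm_loopTupleC_sub_le U₀ c A).trans (exp_pow_sub_one_le (norm_nonneg A) le_rfl (by linarith))
  have hT0 := norm_loopM_tuple_sub_one_le U₀ c hα
  calc ‖(fun i : Idx P => ((walk (emb c.src) (loopWord P.L c.dir (off i.1) i.2.1 i.2.2)).map (fun s : LStep P j => if s.fwd then NormedSpace.exp (A s.bond) * ((U₀ s.bond : SU N) : Matrix (Fin N) (Fin N) ℂ) else star ((U₀ s.bond : SU N) : Matrix (Fin N) (Fin N) ℂ) * NormedSpace.exp (-(A s.bond)))).prod) - 1‖
      = ‖((fun i : Idx P => ((walk (emb c.src) (loopWord P.L c.dir (off i.1) i.2.1 i.2.2)).map (fun s : LStep P j => if s.fwd then NormedSpace.exp (A s.bond) * ((U₀ s.bond : SU N) : Matrix (Fin N) (Fin N) ℂ) else star ((U₀ s.bond : SU N) : Matrix (Fin N) (Fin N) ℂ) * NormedSpace.exp (-(A s.bond)))).prod) - (fun i : Idx P => loopM (coeField U₀) c i)) + ((fun i : Idx P => loopM (coeField U₀) c i) - 1)‖ := by rw [sub_add_sub_cancel]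
    _ ≤ _ := norm_add_le _ _
    _ ≤ ρ / 50 + ρ / 4 := add_le_add (by linarith) (by linarith)

/-- ★ **`G_c` IS HOLOMORPHIC (ANALYTIC) AT EVERY POINT OF THE POLYDISC** (entire walk products; `eml` analytic at every tuple in the polydisc `‖W_i − 1‖ < 1`, lit `analyticAt_eml`).
[cite: Balaban1987RG1, p.253 («we assume that it is an analytic function»)] -/
theorem analyticAt_cplxRelAvg (c : PBond P (j + 1)) {α ρ : ℝ} (hρ : ρ ≤ innerRadius (specialUnitaryLogChart (Fin N)))
    (hα : ∀ i, dist1 (loopHol U₀ c i) ≤ α) (hα4 : 4 * α ≤ ρ) (A₀ : PBond P j → Matrix (Fin N) (Fin N) ℂ)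
    (hA₀ : 100 * ((((P.d + 2) * P.L : ℕ) : ℝ) * (Real.exp ‖A₀‖ - 1)) ≤ ρ) :
    AnalyticAt ℂ (fun A : PBond P j → Matrix (Fin N) (Fin N) ℂ => eml (fun i : Idx P => ((walk (emb c.src) (loopWord P.L c.dir (off i.1) i.2.1 i.2.2)).map (fun s : LStep P j => if s.fwd then NormedSpace.exp (A s.bond) * ((U₀ s.bond : SU N) : Matrix (Fin N) (Fin N) ℂ) else star ((U₀ s.bond : SU N) : Matrix (Fin N) (Fin N) ℂ) * NormedSpace.exp (-(A s.bond)))).prod) * ((walk (emb c.src) (List.replicate P.L (c.dir, true))).map (fun s : LStep P j => if s.fwd then NormedSpace.exp (A s.bond) * ((U₀ s.bond : SU N) : Matrix (Fin N) (Fin N) ℂ) else star ((U₀ s.bond : SU N) : Matrix (Fin N) (Fin N) ℂ) * NormedSpace.exp (-(A s.bond)))).prod * star ((avgFun (expMeanLogSU (n := Fin N)) U₀ c : SU N) : Matrix (Fin N) (Fin N) ℂ)) A₀ := by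
  have hρ3 : ρ ≤ 1 / 3 := hρ.trans innerRadius_le_third
  have hT := norm_loopTupleC_sub_one_le U₀ c hρ hα hα4 A₀ hA₀
  have hi : ∀ i : Idx P, ‖(fun i : Idx P => ((walk (emb c.src) (loopWord P.L c.dir (off i.1) i.2.1 i.2.2)).map (fun s : LStep P j => if s.fwd then NormedSpace.exp (A₀ s.bond) * ((U₀ s.bond : SU N) : Matrix (Fin N) (Fin N) ℂ) else star ((U₀ s.bond : SU N) : Matrix (Fin N) (Fin N) ℂ) * NormedSpace.exp (-(A₀ s.bond)))).prod) i - 1‖ < 1 := fun i => by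
    have h := norm_le_pi_norm ((fun i : Idx P => ((walk (emb c.src) (loopWord P.L c.dir (off i.1) i.2.1 i.2.2)).map (fun s : LStep P j => if s.fwd then NormedSpace.exp (A₀ s.bond) * ((U₀ s.bond : SU N) : Matrix (Fin N) (Fin N) ℂ) else star ((U₀ s.bond : SU N) : Matrix (Fin N) (Fin N) ℂ) * NormedSpace.exp (-(A₀ s.bond)))).prod) - 1) i
    rw [Pi.sub_apply, Pi.one_apply] at h
    exact (h.trans hT).trans_lt (by linarith)
  have heml : AnalyticAt ℂ (eml : (Idx P → Matrix (Fin N) (Fin N) ℂ) → Matrix (Fin N) (Fin N) ℂ) (fun i : Idx P => ((walk (emb c.src) (loopWord P.L c.dir (off i.1) i.2.1 i.2.2)).map (fun s : LStep P j => if s.fwd then NormedSpace.exp (A₀ s.bond) * ((U₀ s.bond : SU N) : Matrix (Fin N) (Fin N) ℂ) else star ((U₀ s.bond : SU N) : Matrix (Fin N) (Fin N) ℂ) * NormedSpace.exp (-(A₀ s.bond)))).prod) := ExpMeanLog.analyticAt_eml hi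
  exact ((heml.comp (analyticAt_loopTupleC U₀ c A₀)).mul (analyticAt_holC U₀ _ A₀)).mul analyticAt_const

/-- `G_c(0) = Ū(U₀)(c)·Ū(U₀)(c)⋆ = 1` on the guard. [cite: Balaban1987RG1, (0.4) p.253 (bookkeeping)] -/
theorem cplxRelAvg_zero (c : PBond P (j + 1)) (hsmall : Small (expMeanLogSU (n := Fin N)) U₀ c) :
    eml (fun i : Idx P => ((walk (emb c.src) (loopWord P.L c.dir (off i.1) i.2.1 i.2.2)).map (fun s : LStep P j => if s.fwd then NormedSpace.exp ((0 : PBond P j → Matrix (Fin N) (Fin N) ℂ) s.bond) * ((U₀ s.bond : SU N) : Matrix (Fin N) (Fin N) ℂ) else star ((U₀ s.bond : SU N) : Matrix (Fin N) (Fin N) ℂ) * NormedSpace.exp (-((0 : PBond P j → Matrix (Fin N) (Fin N) ℂ) s.bond)))).prod) * ((walk (emb c.src) (List.replicate P.L (c.dir, true))).map (fun s : LStep P j => if s.fwd then NormedSpace.exp ((0 : PBond P j → Matrix (Fin N) (Fin N) ℂ) s.bond) * ((U₀ s.bond : SU N) : Matrix (Fin N) (Fin N) ℂ) else star ((U₀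 s.bond : SU N) : Matrix (Fin N) (Fin N) ℂ) * NormedSpace.exp (-((0 : PBond P j → Matrix (Fin N) (Fin N) ℂ) s.bond)))).prod * star ((avgFun (expMeanLogSU (n := Fin N)) U₀ c : SU N) : Matrix (Fin N) (Fin N) ℂ) = 1 := by
  have hT : (fun i : Idx P => ((walk (emb c.src) (loopWord P.L c.dir (off i.1) i.2.1 i.2.2)).map (fun s : LStep P j => if s.fwd then NormedSpace.exp ((0 : PBond P j → Matrix (Fin N) (Fin N) ℂ) s.bond) * ((U₀ s.bond : SU N) : Matrix (Fin N) (Fin N) ℂ) else star ((U₀ s.bond : SU N) : Matrix (Fin N) (Fin N) ℂ) * NormedSpace.exp (-((0 : PBond P j → Matrix (Fin N) (Fin N) ℂ) s.bond)))).prod) = fun i : Idx P => loopM (coeField U₀) c i := funext fun i => holC_zero U₀ _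
  rw [hT, holC_zero]
  have h := coe_avgFun_of_small U₀ c hsmall
  unfold avgM corrM axialM at h
  rw [← h, coe_mul_star_coe_SU]

/-- ★★ **`Φ_c = log ∘ G_c` IS HOLOMORPHIC (ANALYTIC) AT EVERY POINT OF THE POLYDISC** (`‖G_c(A) − 1‖ ≤ 27ℓ(e^{‖A‖} − 1) ≤ 0.27ρ < 1`, the series `log` is analytic there,
lit `MatrixLog.analyticAt_mlog`). [cite: Balaban1985Averaging, Prop. 3 (121) p.36 («Q(V₀, A, c) = (1∕i) log … is an analytic function of A»)] -/
theorem analyticAt_cplxChartRead (c : PBond P (j + 1)) {α ρ : ℝ} (hρ : ρ ≤ innerRadius (specialUnitaryLogChart (Fin N)))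
    (hα : ∀ i, dist1 (loopHol U₀ c i) ≤ α) (hα4 : 4 * α ≤ ρ) (A₀ : PBond P j → Matrix (Fin N) (Fin N) ℂ)
    (hA₀ : 100 * ((((P.d + 2) * P.L : ℕ) : ℝ) * (Real.exp ‖A₀‖ - 1)) ≤ ρ) :
    AnalyticAt ℂ (fun A : PBond P j → Matrix (Fin N) (Fin N) ℂ => mlog (eml (fun i : Idx P => ((walk (emb c.src) (loopWord P.L c.dir (off i.1) i.2.1 i.2.2)).map (fun s : LStep P j => if s.fwd then NormedSpace.exp (A s.bond) * ((U₀ s.bond : SU N) : Matrix (Fin N) (Fin N) ℂ) else star ((U₀ s.bond : SU N) : Matrix (Fin N) (Fin N) ℂ) * NormedSpace.exp (-(A s.bond)))).prod) * ((walk (emb c.src) (List.replicate P.L (c.dir, true))).map (fun s : LStep P j => if s.fwd then NormedSpace.exp (A s.bond) * ((U₀ s.bond : SU N) : Matrix (Fin N) (Fin N) ℂ) else star ((U₀ s.bond : SU N) : Matrix (Fin N) (Fin N) ℂ) * NormedSpace.exp (-(A s.bond)))).prod * star ((avgFun (expMeanLogSU (n := Fin N)) U₀ c : SU N) : Matrix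 (Fin N) (Fin N) ℂ))) A₀ := by
  have hρ3 : ρ ≤ 1 / 3 := hρ.trans innerRadius_le_third
  have hG : ‖eml (fun i : Idx P => ((walk (emb c.src) (loopWord P.L c.dir (off i.1) i.2.1 i.2.2)).map (fun s : LStep P j => if s.fwd then NormedSpace.exp (A₀ s.bond) * ((U₀ s.bond : SU N) : Matrix (Fin N) (Fin N) ℂ) else star ((U₀ s.bond : SU N) : Matrix (Fin N) (Fin N) ℂ) * NormedSpace.exp (-(A₀ s.bond)))).prod) * ((walk (emb c.src) (List.replicate P.L (c.dir, true))).map (fun s : LStep P j => if s.fwd then NormedSpace.exp (A₀ s.bond) * ((U₀ s.bond : SU N) : Matrix (Fin N) (Fin N) ℂ) else star ((U₀ s.bond : SU N) : Matrix (Fin N) (Fin N) ℂ) * NormedSpace.exp (-(A₀ s.bond)))).prod * star ((avgFun (expMeanLogSU (n := Fin N)) U₀ c : SU N) : Matrix (Fin N) (Fin N) ℂ) - 1‖ < 1 :=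
    (norm_cplxRelAvg_sub_one_le U₀ c hρ hα hα4 A₀ hA₀).trans_lt (by linarith)
  have h1 := analyticAt_cplxRelAvg U₀ c hρ hα hα4 A₀ hA₀
  have h2 : AnalyticAt ℂ (fun Y : Matrix (Fin N) (Fin N) ℂ => mlog Y) (eml (fun i : Idx P => ((walk (emb c.src) (loopWord P.L c.dir (off i.1) i.2.1 i.2.2)).map (fun s : LStep P j => if s.fwd then NormedSpace.exp (A₀ s.bond) * ((U₀ s.bond : SU N) : Matrix (Fin N) (Fin N) ℂ) else star ((U₀ s.bond : SU N) : Matrix (Fin N) (Fin N) ℂ) * NormedSpace.exp (-(A₀ s.bond)))).prod) * ((walk (emb c.src) (List.replicate P.L (c.dir, true))).map (fun s : LStep P j => if s.fwd then NormedSpace.exp (A₀ s.bond) * ((U₀ s.bond : SU N) : Matrix (Fin N) (Fin N) ℂ) else star ((U₀ s.bond : SU N) : Matrix (Fin N) (Fin N) ℂ) * NormedSpace.exp (-(A₀ s.bond)))).prod * star ((avgFun (expMeanLogSU (n := Fin N)) U₀ c : SU N) : Matrix (Fin N) (Fin N) ℂ)) := analyticAt_mlog hG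
  exact AnalyticAt.comp (g := fun Y : Matrix (Fin N) (Fin N) ℂ => mlog Y) (f := fun A : PBond P j → Matrix (Fin N) (Fin N) ℂ => eml (fun i : Idx P => ((walk (emb c.src) (loopWord P.L c.dir (off i.1) i.2.1 i.2.2)).map (fun s : LStep P j => if s.fwd then NormedSpace.exp (A s.bond) * ((U₀ s.bond : SU N) : Matrix (Fin N) (Fin N) ℂ) else star ((U₀ s.bond : SU N) : Matrix (Fin N) (Fin N) ℂ) * NormedSpace.exp (-(A s.bond)))).prod) * ((walk (emb c.src) (List.replicate P.L (c.dir, true))).map (fun s : LStep P j => if s.fwd then NormedSpace.exp (A s.bond) * ((U₀ s.bond : SU N) : Matrix (Fin N) (Fin N) ℂ) else star ((U₀ s.bond : SU N) : Matrix (Fin N) (Fin N) ℂ) * NormedSpace.exp (-(A s.bond)))).prod * star ((avgFun (expMeanLogSU (n := Fin N)) U₀ c : SU N) : Matrix (Fin N) (Fin N) ℂ)) (x := A₀) h2 h1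

/-- ★★ **`Φ_c` IS ANALYTIC ON THE SUP-NORM BALL `ball 0 a`** whenever `100·ℓ·(e^a − 1) ≤ ρ` — the polydisc «|A| < α₁» of Prop. 3 for the tree's `ψ`, with an explicit radius.
[cite: Balaban1985Averaging, Prop. 3 (121) p.36] -/
theorem analyticOnNhd_cplxChartRead (c : PBond P (j + 1)) {α ρ : ℝ} (hρ : ρ ≤ innerRadius (specialUnitaryLogChart (Fin N)))
    (hα : ∀ i, dist1 (loopHol U₀ c i) ≤ α) (hα4 : 4 * α ≤ ρ) {a : ℝ}
    (ha : 100 * ((((P.d + 2) * P.L : ℕ) : ℝ) * (Real.exp a - 1)) ≤ ρ) :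
    AnalyticOnNhd ℂ (fun A : PBond P j → Matrix (Fin N) (Fin N) ℂ => mlog (eml (fun i : Idx P => ((walk (emb c.src) (loopWord P.L c.dir (off i.1) i.2.1 i.2.2)).map (fun s : LStep P j => if s.fwd then NormedSpace.exp (A s.bond) * ((U₀ s.bond : SU N) : Matrix (Fin N) (Fin N) ℂ) else star ((U₀ s.bond : SU N) : Matrix (Fin N) (Fin N) ℂ) * NormedSpace.exp (-(A s.bond)))).prod) * ((walk (emb c.src) (List.replicate P.L (c.dir, true))).map (fun s : LStep P j => if s.fwd then NormedSpace.exp (A s.bond) * ((U₀ s.bond : SU N) : Matrix (Fin N) (Fin N) ℂ) else star ((U₀ s.bond : SU N) : Matrix (Fin N) (Fin N) ℂ) * NormedSpace.exp (-(A s.bond)))).prod * star ((avgFun (expMeanLogSU (n := Fin N)) U₀ c : SU N) : Matrix (Fin N) (Fin N) ℂ))) (ball 0 a) := by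
  intro A hA
  refine analyticAt_cplxChartRead U₀ c hρ hα hα4 A ?_
  have hAa : ‖A‖ ≤ a := (mem_ball_zero_iff.1 hA).le
  have hmono : Real.exp ‖A‖ - 1 ≤ Real.exp a - 1 := by linarith [Real.exp_le_exp.2 hAa]
  exact le_trans (by gcongr) ha

/-- ★★ **`Φ_c` IS `ℂ`-DIFFERENTIABLE ON THE SUP-NORM BALL `ball 0 a`** whenever `100·ℓ·(e^a − 1) ≤ ρ` (the hypothesis shape of lit `B7TransferAnalyticMean` §1's Cauchy engine).
[cite: Balaban1985Averaging, Prop. 3 (121) p.36] -/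
theorem differentiableOn_cplxChartRead (c : PBond P (j + 1)) {α ρ : ℝ} (hρ : ρ ≤ innerRadius (specialUnitaryLogChart (Fin N)))
    (hα : ∀ i, dist1 (loopHol U₀ c i) ≤ α) (hα4 : 4 * α ≤ ρ) {a : ℝ}
    (ha : 100 * ((((P.d + 2) * P.L : ℕ) : ℝ) * (Real.exp a - 1)) ≤ ρ) :
    DifferentiableOn ℂ (fun A : PBond P j → Matrix (Fin N) (Fin N) ℂ => mlog (eml (fun i : Idx P => ((walk (emb c.src) (loopWord P.L c.dir (off i.1) i.2.1 i.2.2)).map (fun s : LStep P j => if s.fwd then NormedSpace.exp (A s.bond) * ((U₀ s.bond : SU N) : Matrix (Fin N) (Fin N) ℂ) else star ((U₀ s.bond : SU N) : Matrix (Fin N) (Fin N) ℂ) * NormedSpace.exp (-(A s.bond)))).prod) * ((walk (emb c.src) (List.replicate P.L (c.dir, true))).map (fun s : LStep P j => if s.fwd then NormedSpace.exp (A s.bond) * ((U₀ s.bond : SU N) : Matrix (Fin N) (Fin N) ℂ) else star ((U₀ s.bond : SU N) : Matrix (Fin N) (Fin N) ℂ) * NormedSpace.exp (-(A s.bond)))).prod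 * star ((avgFun (expMeanLogSU (n := Fin N)) U₀ c : SU N) : Matrix (Fin N) (Fin N) ℂ))) (ball 0 a) :=
  (analyticOnNhd_cplxChartRead U₀ c hρ hα hα4 ha).differentiableOn

/-- `Φ_c(0) = log 1 = 0`. [cite: Balaban1985Averaging, (120) p.36 (bookkeeping)] -/
theorem cplxChartRead_zero (c : PBond P (j + 1)) (hsmall : Small (expMeanLogSU (n := Fin N)) U₀ c) :
    mlog (eml (fun i : Idx P => ((walk (emb c.src) (loopWord P.L c.dir (off i.1) i.2.1 i.2.2)).map (fun s : LStep P j => if s.fwd then NormedSpace.exp ((0 : PBond P j → Matrix (Fin N) (Fin N) ℂ) s.bond) * ((U₀ s.bond : SU N) : Matrix (Fin N) (Fin N) ℂ) else star ((U₀ s.bond : SU N) : Matrix (Fin N) (Fin N) ℂ) * NormedSpace.exp (-((0 : PBond P j → Matrix (Fin N) (Fin N) ℂ) s.bond)))).prod) * ((walk (emb c.src) (List.replicate P.L (c.dir, true))).map (fun s : LStep P j => if s.fwd then NormedSpace.exp ((0 : PBond P j → Matrix (Fin N) (Fin N) ℂ) s.bond) * ((U₀ s.bond : SU N) : Matrix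 (Fin N) (Fin N) ℂ) else star ((U₀ s.bond : SU N) : Matrix (Fin N) (Fin N) ℂ) * NormedSpace.exp (-((0 : PBond P j → Matrix (Fin N) (Fin N) ℂ) s.bond)))).prod * star ((avgFun (expMeanLogSU (n := Fin N)) U₀ c : SU N) : Matrix (Fin N) (Fin N) ℂ)) = 0 := by
  rw [cplxRelAvg_zero U₀ c hsmall, mlog_one]

/-- ★★ **THE SUP BOUND ON THE POLYDISC**: `‖Φ_c(A)‖ ≤ −log(1 − ‖G_c(A) − 1‖) ≤ 2‖G_c(A) − 1‖ ≤ 54·ℓ·(e^{‖A‖} − 1)` (lit `MatrixLog.norm_mlog_le_neg_log`). [cite: Balaban1985Averaging, Prop. 3 (123) p.36] -/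
theorem norm_cplxChartRead_le (c : PBond P (j + 1)) {α ρ : ℝ} (hρ : ρ ≤ innerRadius (specialUnitaryLogChart (Fin N)))
    (hα : ∀ i, dist1 (loopHol U₀ c i) ≤ α) (hα4 : 4 * α ≤ ρ) (A : PBond P j → Matrix (Fin N) (Fin N) ℂ)
    (hA : 100 * ((((P.d + 2) * P.L : ℕ) : ℝ) * (Real.exp ‖A‖ - 1)) ≤ ρ) :
    ‖mlog (eml (fun i : Idx P => ((walk (emb c.src) (loopWord P.L c.dir (off i.1) i.2.1 i.2.2)).map (fun s : LStep P j => if s.fwd then NormedSpace.exp (A s.bond) * ((U₀ s.bond : SU N) : Matrix (Fin N) (Fin N) ℂ) else star ((U₀ s.bond : SU N) : Matrix (Fin N) (Fin N) ℂ) * NormedSpace.exp (-(A s.bond)))).prod) * ((walk (emb c.src) (List.replicate P.L (c.dir, true))).map (fun s : LStep P j => if s.fwd then NormedSpace.exp (A s.bond) * ((U₀ s.bond : SU N) : Matrix (Fin N) (Fin N) ℂ) else star ((U₀ s.bond : SU N) : Matrix (Fin N) (Fin N) ℂ) * NormedSpace.exp (-(A s.bond)))).prod * star ((avgFun (expMeanLogSU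 (n := Fin N)) U₀ c : SU N) : Matrix (Fin N) (Fin N) ℂ))‖ ≤ 54 * ((((P.d + 2) * P.L : ℕ) : ℝ) * (Real.exp ‖A‖ - 1)) := by
  have hρ3 : ρ ≤ 1 / 3 := hρ.trans innerRadius_le_third
  have hK := norm_cplxRelAvg_sub_one_le U₀ c hρ hα hα4 A hA
  set x : ℝ := ‖eml (fun i : Idx P => ((walk (emb c.src) (loopWord P.L c.dir (off i.1) i.2.1 i.2.2)).map (fun s : LStep P j => if s.fwd then NormedSpace.exp (A s.bond) * ((U₀ s.bond : SU N) : Matrix (Fin N) (Fin N) ℂ) else star ((U₀ s.bond : SU N) : Matrix (Fin N) (Fin N) ℂ) * NormedSpace.exp (-(A s.bond)))).prod) * ((walk (emb c.src) (List.replicate P.L (c.dir, true))).map (fun s : LStep P j => if s.fwd then NormedSpace.exp (A s.bond) * ((U₀ s.bond : SU N) : Matrix (Fin N) (Fin N) ℂ) else star ((U₀ s.bond : SU N) : Matrix (Fin N) (Fin N) ℂ) * NormedSpace.exp (-(A s.bond)))).prod * star ((avgFun (expMeanLogSU (n := Fin N)) U₀ c : SU N) : Matrix (Fin N) (Fin N)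 ℂ) - 1‖ with hx
  have hx0 : 0 ≤ x := norm_nonneg _
  have hx1 : x ≤ 1 / 2 := hK.trans (by linarith)
  have hlog := norm_mlog_le_neg_log (X := eml (fun i : Idx P => ((walk (emb c.src) (loopWord P.L c.dir (off i.1) i.2.1 i.2.2)).map (fun s : LStep P j => if s.fwd then NormedSpace.exp (A s.bond) * ((U₀ s.bond : SU N) : Matrix (Fin N) (Fin N) ℂ) else star ((U₀ s.bond : SU N) : Matrix (Fin N) (Fin N) ℂ) * NormedSpace.exp (-(A s.bond)))).prod) * ((walk (emb c.src) (List.replicate P.L (c.dir, true))).map (fun s : LStep P j => if s.fwd then NormedSpace.exp (A s.bond) * ((U₀ s.bond : SU N) : Matrix (Fin N) (Fin N) ℂ) else star ((U₀ s.bond : SU N) : Matrix (Fin N) (Fin N) ℂ) * NormedSpace.exp (-(A s.bond)))).prod * star ((avgFun (expMeanLogSU (n := Fin N)) U₀ c : SU N) : Matrix (Fin N) (Fin N) ℂ)) (by linarith)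
  -- `−log(1 − x) ≤ x∕(1 − x) ≤ 2x`
  have hpos : 0 < 1 - x := by linarith
  have h1 := Real.log_le_sub_one_of_pos (inv_pos.2 hpos)
  rw [Real.log_inv] at h1
  have hinv : (1 - x)⁻¹ - 1 = x / (1 - x) := by field_simp; ring
  have h2 : x / (1 - x) ≤ 2 * x := by rw [div_le_iff₀ hpos]; nlinarith
  linarith

end Holo

/-! ## §2 The real slice: `↑(ψ_{U₀}(X)(c)) = Φ_c(X̂)` on the polydisc and `↑((Dψ_{U₀}(0)X)(c)) = DΦ_c(0)X̂` -/

section RealSlice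

/-- The matrix field `X̂` of an `𝔰𝔲(N)`-valued bond field has the same sup norm bound: `‖X̂‖ ≤ ‖X‖`. [folklore] -/
theorem norm_coePi_le (X : PBond P j → (specialUnitaryLogChart (Fin N)).lie) : ‖(fun b => ((X b : (specialUnitaryLogChart (Fin N)).lie) : Matrix (Fin N) (Fin N) ℂ))‖ ≤ ‖X‖ := by
  refine (pi_norm_le_iff_of_nonneg (norm_nonneg X)).2 fun b => ?_
  calc ‖(((fun b => ((X b : (specialUnitaryLogChart (Fin N)).lie) : Matrix (Fin N) (Fin N) ℂ))) b)‖ = ‖X b‖ := Submodule.norm_coe (X b)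
    _ ≤ ‖X‖ := norm_le_pi_norm X b

/-- On the polydisc the chart point `Θ^B(X)·U₀` is inside the (0.4) guard at `c` (its loop matrices are `W_{X̂}(loop_i)`, within `ρ∕50 + ρ∕4 < ρ ≤ δ_N` of `1`).
[cite: Balaban1987RG1, (0.4) p.253 (bookkeeping)] -/
theorem small_piExpChart_translate (c : PBond P (j + 1)) {α ρ : ℝ} (hρ : ρ ≤ innerRadius (specialUnitaryLogChart (Fin N)))
    (hα : ∀ i, dist1 (loopHol U₀ c i) ≤ α) (hα4 : 4 * α ≤ ρ) (hρ0 : 0 < ρ) (X : PBond P j → (specialUnitaryLogChart (Fin N)).lie)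
    (hX : 100 * ((((P.d + 2) * P.L : ℕ) : ℝ) * (Real.exp ‖X‖ - 1)) ≤ ρ) :
    Small (expMeanLogSU (n := Fin N)) (fun b => (isChartRep_specialUnitaryGroup (n := Fin N)).expChart (X b) * U₀ b) c := by
  have hX' : 100 * ((((P.d + 2) * P.L : ℕ) : ℝ) * (Real.exp ‖(fun b => ((X b : (specialUnitaryLogChart (Fin N)).lie) : Matrix (Fin N) (Fin N) ℂ))‖ - 1)) ≤ ρ := by
    have hmono : Real.exp ‖(fun b => ((X b : (specialUnitaryLogChart (Fin N)).lie) : Matrix (Fin N) (Fin N) ℂ))‖ - 1 ≤ Real.exp ‖X‖ - 1 := by linarith [Real.exp_le_exp.2 (norm_coePi_le X)]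
    exact le_trans (by gcongr) hX
  have hT := norm_loopTupleC_sub_one_le U₀ c hρ hα hα4 (fun b => ((X b : (specialUnitaryLogChart (Fin N)).lie) : Matrix (Fin N) (Fin N) ℂ)) hX'
  intro i
  have hδ : ρ / 50 + ρ / 4 < deltaSU (Fin N) := by linarith [hρ.trans (innerRadius_le_deltaSU (N := N))]
  refine lt_of_le_of_lt ?_ hδ
  show ‖((loopHol (fun b => (isChartRep_specialUnitaryGroup (n := Fin N)).expChart (X b) * U₀ b) c i : SU N) : Matrix (Fin N) (Fin N) ℂ) - 1‖ ≤ ρ / 50 + ρ / 4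
  rw [coe_loopHol]
  unfold loopM
  rw [← holC_real U₀ (walk (emb c.src) (loopWord P.L c.dir (off i.1) i.2.1 i.2.2)) X]
  have h := norm_le_pi_norm ((fun i : Idx P => ((walk (emb c.src) (loopWord P.L c.dir (off i.1) i.2.1 i.2.2)).map (fun s : LStep P j => if s.fwd then NormedSpace.exp ((fun b => ((X b : (specialUnitaryLogChart (Fin N)).lie) : Matrix (Fin N) (Fin N) ℂ)) s.bond) * ((U₀ s.bond : SU N) : Matrix (Fin N) (Fin N) ℂ) else star ((U₀ s.bond : SU N) : Matrix (Fin N) (Fin N) ℂ) * NormedSpace.exp (-((fun b => ((X b : (specialUnitaryLogChart (Fin N)).lie) : Matrix (Fin N) (Fin N) ℂ)) s.bond)))).prod) - 1) i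
  rw [Pi.sub_apply, Pi.one_apply] at h
  exact h.trans hT

/-- ★★ **REAL SLICE OF `G_c`**: on the polydisc the matrix of the relative average `Ū(Θ^B(X)·U₀)(c)·Ū(U₀)(c)⁻¹` IS `G_c(X̂)` (lit `coe_avgFun_of_small` at the chart point, `holC_real`).
[cite: Balaban1987RG1, (0.4) p.253] -/
theorem coe_relAvg_eq_cplxRelAvg (c : PBond P (j + 1)) {α ρ : ℝ} (hρ : ρ ≤ innerRadius (specialUnitaryLogChart (Fin N)))
    (hα : ∀ i, dist1 (loopHol U₀ c i) ≤ α) (hα4 : 4 * α ≤ ρ) (hρ0 : 0 < ρ) (X : PBond P j → (specialUnitaryLogChart (Fin N)).lie)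
    (hX : 100 * ((((P.d + 2) * P.L : ℕ) : ℝ) * (Real.exp ‖X‖ - 1)) ≤ ρ) :
    ((avgFun (expMeanLogSU (n := Fin N)) (fun b => (isChartRep_specialUnitaryGroup (n := Fin N)).expChart (X b) * U₀ b) c * (avgFun (expMeanLogSU (n := Fin N)) U₀ c)⁻¹ : SU N) : Matrix (Fin N) (Fin N) ℂ) =
      eml (fun i : Idx P => ((walk (emb c.src) (loopWord P.L c.dir (off i.1) i.2.1 i.2.2)).map (fun s : LStep P j => if s.fwd then NormedSpace.exp ((fun b => ((X b : (specialUnitaryLogChart (Fin N)).lie) : Matrix (Fin N) (Fin N) ℂ)) s.bond) * ((U₀ s.bond : SU N) : Matrix (Fin N) (Fin N) ℂ) else star ((U₀ s.bond : SU N) : Matrix (Fin N) (Fin N) ℂ) * NormedSpace.exp (-((fun b => ((X b : (specialUnitaryLogChart (Fin N)).lie) : Matrix (Fin N) (Fin N) ℂ)) s.bond)))).prod) * ((walk (emb c.src) (List.replicate P.L (c.dir, true))).map (fun s : LStep P j => if s.fwd then NormedSpace.exp ((fun b => ((X b : (specialUnitaryLogChart (Fin N)).lie) : Matrix (Fin N)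 (Fin N) ℂ)) s.bond) * ((U₀ s.bond : SU N) : Matrix (Fin N) (Fin N) ℂ) else star ((U₀ s.bond : SU N) : Matrix (Fin N) (Fin N) ℂ) * NormedSpace.exp (-((fun b => ((X b : (specialUnitaryLogChart (Fin N)).lie) : Matrix (Fin N) (Fin N) ℂ)) s.bond)))).prod * star ((avgFun (expMeanLogSU (n := Fin N)) U₀ c : SU N) : Matrix (Fin N) (Fin N) ℂ) := by
  have h1 := coe_relAvg_eq_of_small U₀ c (small_piExpChart_translate U₀ c hρ hα hα4 hρ0 X hX)
  have h2 : avgM (coeField (fun b => (isChartRep_specialUnitaryGroup (n := Fin N)).expChart (X b) * U₀ b)) c = eml (fun i : Idx P => ((walk (emb c.src) (loopWord P.L c.dir (off i.1) i.2.1 i.2.2)).map (fun s : LStep P j => if s.fwd then NormedSpace.exp ((fun b => ((X b : (specialUnitaryLogChart (Fin N)).lie) : Matrix (Fin N) (Fin N) ℂ)) s.bond) * ((U₀ s.bond : SU N) : Matrix (Fin N) (Fin N) ℂ) else star ((U₀ s.bond : SU N) : Matrix (Fin N) (Fin N) ℂ) * NormedSpace.exp (-((fun b => ((X b : (specialUnitaryLogChart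 (Fin N)).lie) : Matrix (Fin N) (Fin N) ℂ)) s.bond)))).prod) * ((walk (emb c.src) (List.replicate P.L (c.dir, true))).map (fun s : LStep P j => if s.fwd then NormedSpace.exp ((fun b => ((X b : (specialUnitaryLogChart (Fin N)).lie) : Matrix (Fin N) (Fin N) ℂ)) s.bond) * ((U₀ s.bond : SU N) : Matrix (Fin N) (Fin N) ℂ) else star ((U₀ s.bond : SU N) : Matrix (Fin N) (Fin N) ℂ) * NormedSpace.exp (-((fun b => ((X b : (specialUnitaryLogChart (Fin N)).lie) : Matrix (Fin N) (Fin N) ℂ)) s.bond)))).prod := by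
    have hT : (fun i : Idx P => ((walk (emb c.src) (loopWord P.L c.dir (off i.1) i.2.1 i.2.2)).map (fun s : LStep P j => if s.fwd then NormedSpace.exp ((fun b => ((X b : (specialUnitaryLogChart (Fin N)).lie) : Matrix (Fin N) (Fin N) ℂ)) s.bond) * ((U₀ s.bond : SU N) : Matrix (Fin N) (Fin N) ℂ) else star ((U₀ s.bond : SU N) : Matrix (Fin N) (Fin N) ℂ) * NormedSpace.exp (-((fun b => ((X b : (specialUnitaryLogChart (Fin N)).lie) : Matrix (Fin N) (Fin N) ℂ)) s.bond)))).prod) = fun i : Idx P => loopM (coeField (fun b => (isChartRep_specialUnitaryGroup (n := Fin N)).expChart (X b) * U₀ b)) c i :=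
      funext fun i => holC_real U₀ (walk (emb c.src) (loopWord P.L c.dir (off i.1) i.2.1 i.2.2)) X
    rw [hT, holC_real U₀ (walk (emb c.src) (List.replicate P.L (c.dir, true))) X]
    rfl
  rw [h1, h2]

/-- ★★★ **REAL SLICE OF `Φ_c`**: on the polydisc the MATRIX of the chart-read one-step average `ψ_{U₀}(X)(c) = Λ(Ū(Θ^B(X)·U₀)(c)·Ū(U₀)(c)⁻¹)` IS `Φ_c(X̂) = log G_c(X̂)`
(`‖G_c(X̂) − 1‖ ≤ 27ℓ(e^{‖X‖} − 1) < ρ ≤` inner radius, so `Λ = log`, lit `coe_logChart`). [cite: Balaban1985Averaging, Prop. 3 (121) p.36; Helgason2000, Ch. I §1 Thm. 1.14] -/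
theorem coe_chartRead_eq_cplxChartRead (c : PBond P (j + 1)) {α ρ : ℝ} (hρ : ρ ≤ innerRadius (specialUnitaryLogChart (Fin N)))
    (hα : ∀ i, dist1 (loopHol U₀ c i) ≤ α) (hα4 : 4 * α ≤ ρ) (hρ0 : 0 < ρ) (X : PBond P j → (specialUnitaryLogChart (Fin N)).lie)
    (hX : 100 * ((((P.d + 2) * P.L : ℕ) : ℝ) * (Real.exp ‖X‖ - 1)) ≤ ρ) :
    (((isChartRep_specialUnitaryGroup (n := Fin N)).logChart (avgFun (expMeanLogSU (n := Fin N)) (fun b => (isChartRep_specialUnitaryGroup (n := Fin N)).expChart (X b) * U₀ b) c * (avgFun (expMeanLogSU (n := Fin N)) U₀ c)⁻¹) : (specialUnitaryLogChart (Fin N)).lie) : Matrix (Fin N) (Fin N) ℂ) =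
      mlog (eml (fun i : Idx P => ((walk (emb c.src) (loopWord P.L c.dir (off i.1) i.2.1 i.2.2)).map (fun s : LStep P j => if s.fwd then NormedSpace.exp ((fun b => ((X b : (specialUnitaryLogChart (Fin N)).lie) : Matrix (Fin N) (Fin N) ℂ)) s.bond) * ((U₀ s.bond : SU N) : Matrix (Fin N) (Fin N) ℂ) else star ((U₀ s.bond : SU N) : Matrix (Fin N) (Fin N) ℂ) * NormedSpace.exp (-((fun b => ((X b : (specialUnitaryLogChart (Fin N)).lie) : Matrix (Fin N) (Fin N) ℂ)) s.bond)))).prod) * ((walk (emb c.src) (List.replicate P.L (c.dir, true))).map (fun s : LStep P j => if s.fwd then NormedSpace.exp ((fun b => ((X b : (specialUnitaryLogChart (Fin N)).lie) : Matrix (Fin N) (Fin N) ℂ)) s.bond) * ((U₀ s.bond : SU N) : Matrix (Fin N) (Fin N) ℂ) else star ((U₀ s.bond : SU N) : Matrix (Fin N) (Fin N) ℂ) * NormedSpace.exp (-((fun b => ((X b : (specialUnitaryLogChart (Fin N)).lie) : Matrix (Fin N) (Fin N) ℂ)) s.bond)))).prod * star ((avgFun (expMeanLogSU (n := Fin N))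 U₀ c : SU N) : Matrix (Fin N) (Fin N) ℂ)) := by
  have hcoe := coe_relAvg_eq_cplxRelAvg U₀ c hρ hα hα4 hρ0 X hX
  have hX' : 100 * ((((P.d + 2) * P.L : ℕ) : ℝ) * (Real.exp ‖(fun b => ((X b : (specialUnitaryLogChart (Fin N)).lie) : Matrix (Fin N) (Fin N) ℂ))‖ - 1)) ≤ ρ := by
    have hmono : Real.exp ‖(fun b => ((X b : (specialUnitaryLogChart (Fin N)).lie) : Matrix (Fin N) (Fin N) ℂ))‖ - 1 ≤ Real.exp ‖X‖ - 1 := by linarith [Real.exp_le_exp.2 (norm_coePi_le X)]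
    exact le_trans (by gcongr) hX
  have hK := norm_cplxRelAvg_sub_one_le U₀ c hρ hα hα4 (fun b => ((X b : (specialUnitaryLogChart (Fin N)).lie) : Matrix (Fin N) (Fin N) ℂ)) hX'
  have hlt : ‖fundamentalRep (Fin N) (avgFun (expMeanLogSU (n := Fin N)) (fun b => (isChartRep_specialUnitaryGroup (n := Fin N)).expChart (X b) * U₀ b) c *
      (avgFun (expMeanLogSU (n := Fin N)) U₀ c)⁻¹) - 1‖ < innerRadius (specialUnitaryLogChart (Fin N)) := by
    rw [fundamentalRep_apply, hcoe]
    refine hK.trans_lt (lt_of_lt_of_le ?_ hρ)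
    have hρ3 : ρ ≤ 1 / 3 := hρ.trans innerRadius_le_third
    nlinarith
  rw [(isChartRep_specialUnitaryGroup (n := Fin N)).coe_logChart hlt, fundamentalRep_apply, hcoe]


/-- ★ **THE RELATIVE AVERAGE IS INSIDE THE LOG-CHART WINDOW ON THE POLYDISC, QUANTIFIED**: `‖↑(Ū(Θ^B(X)·U₀)(c)·Ū(U₀)(c)⁻¹) − 1‖ ≤ 27·ℓ·(e^{‖X‖} − 1)` (`< ρ ≤` inner radius) — the window
hypothesis of the quaternion-read dictionaries (Q1∕Q8 `hwin`) DISCHARGED from `‖X‖`. [cite: Balaban1987RG1, (0.4), (0.8) p.253] -/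
theorem norm_coe_relAvg_sub_one_le (c : PBond P (j + 1)) {α ρ : ℝ} (hρ : ρ ≤ innerRadius (specialUnitaryLogChart (Fin N)))
    (hα : ∀ i, dist1 (loopHol U₀ c i) ≤ α) (hα4 : 4 * α ≤ ρ) (hρ0 : 0 < ρ) (X : PBond P j → (specialUnitaryLogChart (Fin N)).lie)
    (hX : 100 * ((((P.d + 2) * P.L : ℕ) : ℝ) * (Real.exp ‖X‖ - 1)) ≤ ρ) :
    ‖((avgFun (expMeanLogSU (n := Fin N)) (fun b => (isChartRep_specialUnitaryGroup (n := Fin N)).expChart (X b) * U₀ b) c * (avgFun (expMeanLogSU (n := Fin N)) U₀ c)⁻¹ : SU N) : Matrix (Fin N) (Fin N) ℂ) - 1‖ ≤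
      27 * ((((P.d + 2) * P.L : ℕ) : ℝ) * (Real.exp ‖X‖ - 1)) := by
  rw [coe_relAvg_eq_cplxRelAvg U₀ c hρ hα hα4 hρ0 X hX]
  have hX' : 100 * ((((P.d + 2) * P.L : ℕ) : ℝ) * (Real.exp ‖(fun b => ((X b : (specialUnitaryLogChart (Fin N)).lie) : Matrix (Fin N) (Fin N) ℂ))‖ - 1)) ≤ ρ := by
    have hmono : Real.exp ‖(fun b => ((X b : (specialUnitaryLogChart (Fin N)).lie) : Matrix (Fin N) (Fin N) ℂ))‖ - 1 ≤ Real.exp ‖X‖ - 1 := by linarith [Real.exp_le_exp.2 (norm_coePi_le X)]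
    exact le_trans (by gcongr) hX
  have hmono : Real.exp ‖(fun b => ((X b : (specialUnitaryLogChart (Fin N)).lie) : Matrix (Fin N) (Fin N) ℂ))‖ - 1 ≤ Real.exp ‖X‖ - 1 := by linarith [Real.exp_le_exp.2 (norm_coePi_le X)]
  exact (norm_cplxRelAvg_sub_one_le U₀ c hρ hα hα4 (fun b => ((X b : (specialUnitaryLogChart (Fin N)).lie) : Matrix (Fin N) (Fin N) ℂ)) hX').trans (by gcongr)

/-- ★ **THE SIZE OF THE CHART-READ VALUE ON THE POLYDISC**: `‖↑(ψ_{U₀}(X)(c))‖ ≤ 54·ℓ·(e^{‖X‖} − 1)` (real slice of `norm_cplxChartRead_le`). [cite: Balaban1985Averaging, Prop. 3 (120)-(121) p.36] -/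
theorem norm_coe_chartRead_le (c : PBond P (j + 1)) {α ρ : ℝ} (hρ : ρ ≤ innerRadius (specialUnitaryLogChart (Fin N)))
    (hα : ∀ i, dist1 (loopHol U₀ c i) ≤ α) (hα4 : 4 * α ≤ ρ) (hρ0 : 0 < ρ) (X : PBond P j → (specialUnitaryLogChart (Fin N)).lie)
    (hX : 100 * ((((P.d + 2) * P.L : ℕ) : ℝ) * (Real.exp ‖X‖ - 1)) ≤ ρ) :
    ‖(((isChartRep_specialUnitaryGroup (n := Fin N)).logChart (avgFun (expMeanLogSU (n := Fin N)) (fun b => (isChartRep_specialUnitaryGroup (n := Fin N)).expChart (X b) * U₀ b) c * (avgFun (expMeanLogSU (n := Fin N)) U₀ c)⁻¹) : (specialUnitaryLogChart (Fin N)).lie) : Matrix (Fin N) (Fin N) ℂ)‖ ≤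
      54 * ((((P.d + 2) * P.L : ℕ) : ℝ) * (Real.exp ‖X‖ - 1)) := by
  rw [coe_chartRead_eq_cplxChartRead U₀ c hρ hα hα4 hρ0 X hX]
  have hX' : 100 * ((((P.d + 2) * P.L : ℕ) : ℝ) * (Real.exp ‖(fun b => ((X b : (specialUnitaryLogChart (Fin N)).lie) : Matrix (Fin N) (Fin N) ℂ))‖ - 1)) ≤ ρ := by
    have hmono : Real.exp ‖(fun b => ((X b : (specialUnitaryLogChart (Fin N)).lie) : Matrix (Fin N) (Fin N) ℂ))‖ - 1 ≤ Real.exp ‖X‖ - 1 := by linarith [Real.exp_le_exp.2 (norm_coePi_le X)]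
    exact le_trans (by gcongr) hX
  have hmono : Real.exp ‖(fun b => ((X b : (specialUnitaryLogChart (Fin N)).lie) : Matrix (Fin N) (Fin N) ℂ))‖ - 1 ≤ Real.exp ‖X‖ - 1 := by linarith [Real.exp_le_exp.2 (norm_coePi_le X)]
  exact (norm_cplxChartRead_le U₀ c hρ hα hα4 (fun b => ((X b : (specialUnitaryLogChart (Fin N)).lie) : Matrix (Fin N) (Fin N) ℂ)) hX').trans (by gcongr)

/-- ★★★ **THE DERIVATIVES AGREE AT `0`**: for a background in the loop `α`-guard at EVERY coarse bond, the matrix of the chart-read derivative `(Dψ_{U₀}(0) X)(c)` ((D0)∕(D1)'s currency) IS the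
complex derivative `DΦ_c(0) X̂` (`↑∘ψ(·)(c) = Φ_c ∘ (X ↦ X̂)` near `0`; chain rule through the real-linear inclusion `𝔰𝔲(N) ↪ M_N(ℂ)`). [cite: Balaban1985Averaging, Prop. 3 (122) p.36] -/
theorem coe_fderiv_chartRead_apply_eq {α ρ : ℝ} (hρ : ρ ≤ innerRadius (specialUnitaryLogChart (Fin N)))
    (hαall : ∀ c i, dist1 (loopHol U₀ c i) ≤ α) (hα4 : 4 * α ≤ ρ) (hρ0 : 0 < ρ)
    (X : PBond P j → (specialUnitaryLogChart (Fin N)).lie) (c : PBond P (j + 1)) :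
    ((fderiv ℝ (fun (A : PBond P j → (specialUnitaryLogChart (Fin N)).lie) (c : PBond P (j + 1)) => (isChartRep_specialUnitaryGroup (n := Fin N)).logChart (avgFun (expMeanLogSU (n := Fin N)) (fun b => (isChartRep_specialUnitaryGroup (n := Fin N)).expChart (A b) * U₀ b) c * (avgFun (expMeanLogSU (n := Fin N)) U₀ c)⁻¹)) 0 X c : (specialUnitaryLogChart (Fin N)).lie) : Matrix (Fin N) (Fin N) ℂ) =
      fderiv ℂ (fun A : PBond P j → Matrix (Fin N) (Fin N) ℂ => mlog (eml (fun i : Idx P => ((walk (emb c.src) (loopWord P.L c.dir (off i.1) i.2.1 i.2.2)).map (fun s : LStep P j => if s.fwd then NormedSpace.exp (A s.bond) * ((U₀ s.bond : SU N) : Matrix (Fin N) (Fin N) ℂ) else star ((U₀ s.bond : SU N) : Matrix (Fin N) (Fin N) ℂ) * NormedSpace.exp (-(A s.bond)))).prod) * ((walk (emb c.src) (List.replicate P.L (c.dir, true))).map (fun s : LStep P j => if s.fwd then NormedSpace.exp (A s.bond) * ((U₀ s.bond : SU N) : Matrix (Fin N) (Fin N) ℂ) else star ((U₀ s.bond : SU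 N) : Matrix (Fin N) (Fin N) ℂ) * NormedSpace.exp (-(A s.bond)))).prod * star ((avgFun (expMeanLogSU (n := Fin N)) U₀ c : SU N) : Matrix (Fin N) (Fin N) ℂ))) 0 (fun b => ((X b : (specialUnitaryLogChart (Fin N)).lie) : Matrix (Fin N) (Fin N) ℂ)) := by
  set h := (isChartRep_specialUnitaryGroup (n := Fin N)) with hh
  set ψ := (fun (A : PBond P j → (specialUnitaryLogChart (Fin N)).lie) (c : PBond P (j + 1)) => (isChartRep_specialUnitaryGroup (n := Fin N)).logChart (avgFun (expMeanLogSU (n := Fin N)) (fun b => (isChartRep_specialUnitaryGroup (n := Fin N)).expChart (A b) * U₀ b) c * (avgFun (expMeanLogSU (n := Fin N)) U₀ c)⁻¹)) with hψ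
  have hℓ1 : (1 : ℝ) ≤ (((P.d + 2) * P.L : ℕ) : ℝ) := by exact_mod_cast Nat.one_le_iff_ne_zero.2 (Nat.mul_ne_zero (by omega) P.L_pos.ne')
  have hαδ : α < deltaSU (Fin N) := by
    linarith [hρ.trans (innerRadius_le_deltaSU (N := N)), deltaSU_pos (n := Fin N)]
  have hsmall : ∀ c, Small (expMeanLogSU (n := Fin N)) U₀ c := fun c i => lt_of_le_of_lt (hαall c i) hαδ
  -- `ψ` and its `c`-component are differentiable at `0`
  have hψd : DifferentiableAt ℝ ψ 0 := (contDiffAt_chartRead_avgFun (P := P) (N := N) U₀ hsmall).differentiableAt (by simp)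
  have hψc : ∀ c', DifferentiableAt ℝ (fun A => ψ A c') 0 := fun c' =>
    (differentiableAt_pi (𝕜 := ℝ) (Φ := ψ) (x := (0 : PBond P j → (specialUnitaryLogChart (Fin N)).lie))).1 hψd c'
  have hpi : fderiv ℝ ψ 0 X c = fderiv ℝ (fun A => ψ A c) 0 X := by
    have e := fderiv_pi (𝕜 := ℝ) (φ := fun (c' : PBond P (j + 1)) (A : PBond P j → (specialUnitaryLogChart (Fin N)).lie) => ψ A c') (x := 0) hψc
    show fderiv ℝ (fun A c' => ψ A c') 0 X c = _
    rw [e]; rfl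
  rw [hpi, coe_fderiv_apply_eq (specialUnitaryLogChart (Fin N)).lie (hψc c) X]
  -- near `0`, the coercion of the `c`-component IS `Φ_c ∘ (X ↦ X̂)`
  set ι : (PBond P j → (specialUnitaryLogChart (Fin N)).lie) →L[ℝ] (PBond P j → Matrix (Fin N) (Fin N) ℂ) :=
    ContinuousLinearMap.pi fun b => ((specialUnitaryLogChart (Fin N)).lie).subtypeL.comp (ContinuousLinearMap.proj b) with hι
  have hιapp : ∀ Y : PBond P j → (specialUnitaryLogChart (Fin N)).lie, ι Y = fun b => ((Y b : (specialUnitaryLogChart (Fin N)).lie) : Matrix (Fin N) (Fin N) ℂ) := fun Y => rfl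
  set a : ℝ := ρ / (200 * (((P.d + 2) * P.L : ℕ) : ℝ)) with ha
  have ha0 : 0 < a := by rw [ha]; positivity
  have ha1 : a ≤ 1 := by
    rw [ha, div_le_one (by positivity)]
    linarith [hρ.trans innerRadius_le_third]
  have hea : Real.exp a - 1 ≤ 2 * a := by
    have h3 := Real.abs_exp_sub_one_sub_id_le (x := a) (by rw [abs_of_nonneg ha0.le]; exact ha1)
    have h4 : Real.exp a - 1 - a ≤ a ^ 2 := (le_abs_self _).trans h3
    nlinarith
  have hball : ∀ Y : PBond P j → (specialUnitaryLogChart (Fin N)).lie, ‖Y‖ < a → 100 * ((((P.d + 2) * P.L : ℕ) : ℝ) * (Real.exp ‖Y‖ - 1)) ≤ ρ := by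
    intro Y hY
    have hmono : Real.exp ‖Y‖ - 1 ≤ 2 * a := by linarith [Real.exp_le_exp.2 hY.le]
    calc 100 * ((((P.d + 2) * P.L : ℕ) : ℝ) * (Real.exp ‖Y‖ - 1)) ≤ 100 * ((((P.d + 2) * P.L : ℕ) : ℝ) * (2 * a)) := by gcongr
      _ = ρ := by rw [ha]; field_simp; norm_num
  have heq : (fun A : PBond P j → (specialUnitaryLogChart (Fin N)).lie => ((ψ A c : (specialUnitaryLogChart (Fin N)).lie) : Matrix (Fin N) (Fin N) ℂ)) =ᶠ[𝓝 0]
      fun A => (fun B : PBond P j → Matrix (Fin N) (Fin N) ℂ => mlog (eml (fun i : Idx P => ((walk (emb c.src) (loopWord P.L c.dir (off i.1) i.2.1 i.2.2)).map (fun s : LStep P j => if s.fwd then NormedSpace.exp (B s.bond) * ((U₀ s.bond : SU N) : Matrix (Fin N) (Fin N) ℂ) else star ((U₀ s.bond : SU N) : Matrix (Fin N) (Fin N) ℂ) * NormedSpace.exp (-(B s.bond)))).prod) * ((walk (emb c.src) (List.replicate P.L (c.dir, true))).map (fun s : LStep P j => if s.fwd then NormedSpace.exp (B s.bond) * ((U₀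 s.bond : SU N) : Matrix (Fin N) (Fin N) ℂ) else star ((U₀ s.bond : SU N) : Matrix (Fin N) (Fin N) ℂ) * NormedSpace.exp (-(B s.bond)))).prod * star ((avgFun (expMeanLogSU (n := Fin N)) U₀ c : SU N) : Matrix (Fin N) (Fin N) ℂ))) (ι A) := by
    filter_upwards [Metric.ball_mem_nhds (0 : PBond P j → (specialUnitaryLogChart (Fin N)).lie) ha0] with Y hY
    rw [hιapp]
    exact coe_chartRead_eq_cplxChartRead U₀ c hρ (hαall c) hα4 hρ0 Y (hball Y (mem_ball_zero_iff.1 hY))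
  rw [heq.fderiv_eq]
  -- chain rule through the real-linear inclusion
  have hΦ : DifferentiableAt ℂ (fun B : PBond P j → Matrix (Fin N) (Fin N) ℂ => mlog (eml (fun i : Idx P => ((walk (emb c.src) (loopWord P.L c.dir (off i.1) i.2.1 i.2.2)).map (fun s : LStep P j => if s.fwd then NormedSpace.exp (B s.bond) * ((U₀ s.bond : SU N) : Matrix (Fin N) (Fin N) ℂ) else star ((U₀ s.bond : SU N) : Matrix (Fin N) (Fin N) ℂ) * NormedSpace.exp (-(B s.bond)))).prod) * ((walk (emb c.src) (List.replicate P.L (c.dir, true))).map (fun s : LStep P j => if s.fwd then NormedSpace.exp (B s.bond) * ((U₀ s.bond : SU N) : Matrix (Fin N) (Fin N) ℂ) else star ((U₀ s.bond : SU N) : Matrix (Fin N) (Fin N) ℂ) * NormedSpace.exp (-(B s.bond)))).prod * star ((avgFun (expMeanLogSU (n := Fin N)) U₀ c : SU N) : Matrix (Fin N) (Fin N) ℂ))) (ι 0) := by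
    rw [map_zero]
    exact (analyticAt_cplxChartRead U₀ c hρ (hαall c) hα4 0 (by rw [norm_zero, Real.exp_zero, sub_self, mul_zero, mul_zero]; exact hρ0.le)).differentiableAt
  have hcomp := (hΦ.hasFDerivAt.restrictScalars ℝ).comp (0 : PBond P j → (specialUnitaryLogChart (Fin N)).lie) ι.hasFDerivAt
  rw [show (fun A : PBond P j → (specialUnitaryLogChart (Fin N)).lie => (fun B : PBond P j → Matrix (Fin N) (Fin N) ℂ => mlog (eml (fun i : Idx P => ((walk (emb c.src) (loopWord P.L c.dir (off i.1) i.2.1 i.2.2)).map (fun s : LStep P j => if s.fwd then NormedSpace.exp (B s.bond) * ((U₀ s.bond : SU N) : Matrix (Fin N) (Fin N) ℂ) else star ((U₀ s.bond : SU N) : Matrix (Fin N) (Fin N) ℂ) * NormedSpace.exp (-(B s.bond)))).prod) * ((walk (emb c.src) (List.replicate P.L (c.dir, true))).map (fun s : LStep P j => if s.fwd then NormedSpace.exp (B s.bond) * ((U₀ s.bond : SU N) : Matrix (Fin N) (Fin N) ℂ) else star ((U₀ s.bond : SU N) : Matrix (Fin N) (Fin N) ℂ) * NormedSpace.exp (-(B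 s.bond)))).prod * star ((avgFun (expMeanLogSU (n := Fin N)) U₀ c : SU N) : Matrix (Fin N) (Fin N) ℂ))) (ι A)) =
      (fun B : PBond P j → Matrix (Fin N) (Fin N) ℂ => mlog (eml (fun i : Idx P => ((walk (emb c.src) (loopWord P.L c.dir (off i.1) i.2.1 i.2.2)).map (fun s : LStep P j => if s.fwd then NormedSpace.exp (B s.bond) * ((U₀ s.bond : SU N) : Matrix (Fin N) (Fin N) ℂ) else star ((U₀ s.bond : SU N) : Matrix (Fin N) (Fin N) ℂ) * NormedSpace.exp (-(B s.bond)))).prod) * ((walk (emb c.src) (List.replicate P.L (c.dir, true))).map (fun s : LStep P j => if s.fwd then NormedSpace.exp (B s.bond) * ((U₀ s.bond : SU N) : Matrix (Fin N) (Fin N) ℂ) else star ((U₀ s.bond : SU N) : Matrix (Fin N) (Fin N) ℂ) * NormedSpace.exp (-(B s.bond)))).prod * star ((avgFun (expMeanLogSU (n := Fin N)) U₀ c : SU N) : Matrix (Fin N) (Fin N) ℂ))) ∘ ι from rfl, hcomp.fderiv, ContinuousLinearMap.comp_apply,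
    ContinuousLinearMap.coe_restrictScalars', map_zero, hιapp]

end RealSlice

end Summit.QuantumFields.YangMills.Theorems.FluctuationComparisonRegPrIntLS2BetaChartReadCplxAnalytic

end
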